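import Summits.HubbardSuperconductivity.HubbardSuperconductivity.Theorems.CooperPairDMottWalkCooperPairDMottDWaveResidueStructuralGram

/-!
# Route `CooperPairDMottWalk`, crux `CooperPairDMott` (stmt-HubbardSuperconductivity-1177):
# stub D′b `stub_dWaveResidueStructural` — the core of its reduction to two structure statements

Support file for the registered line `Cruxes/CooperPairDMott/Lines/birth.lean`. Stub D′b is the
structural part of clause (c) of the crux: ONE pair (`φ₀` parent ground state of the `(L², 0)` sector,
`φ₂` ground state of the two-hole `(L² − 2, 0)` sector) of the breathing torus `H_L(1, b, U)`, `L = 4k+4`,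
with a macroscopic `d_{x²−y²}` amplitude `z L² ‖φ₀‖² ‖φ₂‖² ≤ |⟨φ₂, Δ_d φ₀⟩|²`, `Δ_d = pairField dWaveFormFactor L`,
given the plaquette data (D′a) and the plaquette grand-canonical window (GCW). The physics: the unique
two-hole ground state is the zero-momentum bottom of the one-plaquette pair band dressed over the parent
`Ω`, so `⟨φ₂, Δ_d Ω⟩ ≈ (m/2)⟨φ₂, Σ_c A_c Ω⟩ ≈ (L/4)·m`, `A_c = (f_c)_*|π⟩⟨σ|` the pair-removal operator of
plaquette `c` (`σ`, `π` the unit `(4,0)` and `(2,0)` plaquette ground states, `m = ⟨π, Δ_d^{(2)} σ⟩ ≠ 0`;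
the intra-plaquette part of `Δ_d` is `(1/2) Σ_c (f_c)_* Δ_d^{(2)}`, `Δ_d^{(2)} = pairField dWaveFormFactor 2`).
This file proves the `L`-uniform VARIATIONAL skeleton of that computation at one even side `L`
(`dWaveResidue_core`): IF (S1) `c₁‖φ₂‖² Σ_c ‖A_cΩ‖² ≤ |⟨φ₂, Σ_c A_cΩ⟩|²` and (S3)
`|⟨φ₂, Δ_dΩ⟩ − (m/2)⟨φ₂, Σ_c A_cΩ⟩| ≤ η L ‖φ₂‖‖Ω‖` with `η ≤ |m|√(c₁/32)`, THEN
`(|m|√(c₁/32) − η)² L² ‖Ω‖²‖φ₂‖² ≤ |⟨φ₂, Δ_d Ω⟩|²`, by the diagonal Gram bound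
`Σ_c ‖A_cΩ‖² = Σ_c Re⟨Ω, (f_c)_*|σ⟩⟨σ|Ω⟩ ≥ (L²/4 − 16bL²/γ)‖Ω‖² ≥ L²‖Ω‖²/8` for `b ≤ γ/128`
(file `…DWaveResidueStructuralGram`) and the triangle inequality. The two structure statements S1 (the
flat pair band: coherent overlap of `φ₂` with the `K = 0` pair removed from the dressed parent) and S3
(locality of the dressed remainder of the pair field) are NOT proved; they are the residual engine-level
content of D′b, consumed as hypotheses by `…DWaveResidueStructural`.

References: D. J. Scalapino, Phys. Rep. 250 (1995) 329, §2; H. Yao, W.-F. Tsai, S. A. Kivelson, PRB 76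
(2007) 161104, eq. (2); H. Tasaki (2020) §2.1. All statements are [folklore] finite-dimensional
estimates; no definition is introduced.
-/

set_option linter.dupNamespace false

noncomputable section

namespace Summit.HubbardSuperconductivity.HubbardSuperconductivity.Theorems.CooperPairDMottWalk

open Matrix Finset Literature.MathematicalPhysics.QuantumLattice Literature.Probability.LatticeModels
open Literature.MathematicalPhysics.QuantumLattice.ThermodynamicLimit (norm_toLp_sq norm_toLp_mulVec_le star_dotProduct_self_eq_re star_dotProduct_eq_inner)
open scoped ComplexOrder Matrix.Norms.L2Operator

/-! ### The core of the reduction at one side `L` -/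

set_option maxHeartbeats 800000 in
/-- **The `d`-wave residue from the two structure hypotheses, at one even side `L`.** Data: the
rank-one defect form of the plaquette (`σ` the unit `(4,0)` plaquette ground state, constants `μ`,
`γ > 0`), a unit plaquette pair state `π`, the block family `f_c`, a ground state `Ω` of the parent
sector `(L² = 2p, 0)` of `H_L(1, b, U)` with `0 < b ≤ γ/128`, any vector `φ₂`, and the local
pair-removal operators `A_c = (f_c)_*|π⟩⟨σ|`. IF
(S1) `c₁ ‖φ₂‖² Σ_c ‖A_c Ω‖² ≤ |⟨φ₂, Σ_c A_c Ω⟩|²` (coherent overlap with the `K = 0` pair removal), and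
(S3) `|⟨φ₂, Δ_d Ω⟩ − (m/2)⟨φ₂, Σ_c A_c Ω⟩|² ≤ η² L² ‖φ₂‖² ‖Ω‖²` (the rest of the pair field is
sub-leading), `m ∈ ℂ`, `η ≤ |m|√(c₁/32)`, THEN `(|m|√(c₁/32) − η)² L² ‖Ω‖² ‖φ₂‖² ≤ |⟨φ₂, Δ_d Ω⟩|²`:
by the diagonal Gram bound `Σ_c ‖A_cΩ‖² = Σ_c Re⟨Ω, (f_c)_*|σ⟩⟨σ|Ω⟩ ≥ L²‖Ω‖²/8`. [folklore] -/
theorem dWaveResidue_core {L : ℕ} [NeZero L] (hL : Even L) (U μ γ b : ℝ)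
    (hγ : 0 < γ) (hb0 : 0 < b) (hbγ : b ≤ γ / 128)
    {σ π : Fock (Orb (FermionTorus 2 2))} (hσ1 : star σ ⬝ᵥ σ = 1) (hσS : σ ∈ szSector (Λ := FermionTorus 2 2) 4 0)
    (hσE : hubbardTorus 2 2 1 U *ᵥ σ = (((hubbardTorus 2 2 1 U).minEnergyOn (szSector 4 0) : ℝ) : ℂ) • σ)
    (hdefect : ∀ v : Fock (Orb (FermionTorus 2 2)),
      γ * ((star v ⬝ᵥ v).re - (star v ⬝ᵥ (vecMulVec σ (star σ) *ᵥ v)).re) ≤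
        (star v ⬝ᵥ ((hubbardTorus 2 2 1 U - (μ : ℂ) • totalNumber) *ᵥ v)).re -
          ((hubbardTorus 2 2 1 U).minEnergyOn (szSector 4 0) - 4 * μ) * (star v ⬝ᵥ v).re)
    (hπ1 : star π ⬝ᵥ π = 1)
    {f : ℕ × ℕ → (FermionTorus 2 2 ↪o FermionTorus 2 L)}
    (hf : ∀ c ∈ Finset.range (L / 2) ×ˢ Finset.range (L / 2), ∀ X j,
      (ofLex (f c X) j : ℕ) = ![c.1 * 2, c.2 * 2] j + (ofLex X j : ℕ))
    {p : ℕ} (hp : L ^ 2 = 2 * p) {Ω : Fock (Orb (FermionTorus 2 L))}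
    (hΩ : IsGroundStateInSector
      (hamiltonian (fermionTorusGraph 2 L \ (⊤ : SimpleGraph (Fin 2 → ℕ)).comap
          (fun (x : FermionTorus 2 L) (i : Fin 2) => (ofLex x i : ℕ) / 2)) 1 U +
        hamiltonian (fermionTorusGraph 2 L ⊓ (⊤ : SimpleGraph (Fin 2 → ℕ)).comap
          (fun (x : FermionTorus 2 L) (i : Fin 2) => (ofLex x i : ℕ) / 2)) b 0) (2 * p) 0 Ω)
    (φ₂ : Fock (Orb (FermionTorus 2 L))) (m : ℂ) {c₁ η : ℝ} (hc₁ : 0 ≤ c₁) (hη0 : 0 ≤ η)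
    (hη : η ≤ ‖m‖ * Real.sqrt (c₁ / 32))
    (hS1 : c₁ * (star φ₂ ⬝ᵥ φ₂).re *
        ∑ c ∈ Finset.range (L / 2) ×ˢ Finset.range (L / 2),
          (star (jwEmbed (orbEmb (f c)) (vecMulVec π (star σ)) *ᵥ Ω) ⬝ᵥ
            (jwEmbed (orbEmb (f c)) (vecMulVec π (star σ)) *ᵥ Ω)).re ≤
      ‖star φ₂ ⬝ᵥ ((∑ c ∈ Finset.range (L / 2) ×ˢ Finset.range (L / 2),
        jwEmbed (orbEmb (f c)) (vecMulVec π (star σ))) *ᵥ Ω)‖ ^ 2)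
    (hS3 : ‖star φ₂ ⬝ᵥ (pairField dWaveFormFactor L *ᵥ Ω) -
        m / 2 * (star φ₂ ⬝ᵥ ((∑ c ∈ Finset.range (L / 2) ×ˢ Finset.range (L / 2),
          jwEmbed (orbEmb (f c)) (vecMulVec π (star σ))) *ᵥ Ω))‖ ^ 2 ≤
      η ^ 2 * (L : ℝ) ^ 2 * (star φ₂ ⬝ᵥ φ₂).re * (star Ω ⬝ᵥ Ω).re) :
    (‖m‖ * Real.sqrt (c₁ / 32) - η) ^ 2 * (L : ℝ) ^ 2 * (star Ω ⬝ᵥ Ω).re * (star φ₂ ⬝ᵥ φ₂).re ≤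
      ‖star φ₂ ⬝ᵥ (pairField dWaveFormFactor L *ᵥ Ω)‖ ^ 2 := by
  set T := Finset.range (L / 2) ×ˢ Finset.range (L / 2) with hT
  set nΩ : ℝ := (star Ω ⬝ᵥ Ω).re with hnΩ
  set nφ : ℝ := (star φ₂ ⬝ᵥ φ₂).re with hnφ
  set B : ℂ := star φ₂ ⬝ᵥ ((∑ c ∈ T, jwEmbed (orbEmb (f c)) (vecMulVec π (star σ))) *ᵥ Ω) with hB
  set D : ℂ := star φ₂ ⬝ᵥ (pairField dWaveFormFactor L *ᵥ Ω) with hD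
  have hΩpos : 0 ≤ nΩ := (Complex.nonneg_iff.1 (dotProduct_star_self_nonneg Ω)).1
  have hφpos : 0 ≤ nφ := (Complex.nonneg_iff.1 (dotProduct_star_self_nonneg φ₂)).1
  have hLpos : (0 : ℝ) ≤ (L : ℝ) ^ 2 := by positivity
  -- the diagonal Gram bound: `Σ_c ‖A_c Ω‖² ≥ L² ‖Ω‖² / 8`
  have hdiag : ∑ c ∈ T, (star (jwEmbed (orbEmb (f c)) (vecMulVec π (star σ)) *ᵥ Ω) ⬝ᵥ
      (jwEmbed (orbEmb (f c)) (vecMulVec π (star σ)) *ᵥ Ω)).re =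
      ∑ c ∈ T, (star Ω ⬝ᵥ (jwEmbed (orbEmb (f c)) (vecMulVec σ (star σ)) *ᵥ Ω)).re :=
    Finset.sum_congr rfl fun c _ => by rw [star_trial_dotProduct_trial (orbEmb (f c)) hπ1 Ω]
  have hgram := sum_re_localVacuum_ge hL U μ γ b hγ hb0 hσ1 hσS hσE hdefect hf hp hΩ
  have hcoef : (L : ℝ) ^ 2 / 8 ≤ (L : ℝ) ^ 2 / 4 - 16 * b * (L : ℝ) ^ 2 / γ := by
    have h1 : 16 * b / γ ≤ 1 / 8 := by
      rw [div_le_iff₀ hγ]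
      linarith
    have h2 : 16 * b * (L : ℝ) ^ 2 / γ = (16 * b / γ) * (L : ℝ) ^ 2 := by ring
    rw [h2]
    nlinarith
  have hS : (L : ℝ) ^ 2 / 8 * nΩ ≤ ∑ c ∈ T, (star (jwEmbed (orbEmb (f c)) (vecMulVec π (star σ)) *ᵥ Ω) ⬝ᵥ
      (jwEmbed (orbEmb (f c)) (vecMulVec π (star σ)) *ᵥ Ω)).re := by
    rw [hdiag]
    exact (mul_le_mul_of_nonneg_right hcoef hΩpos).trans hgram
  -- `|B|² ≥ (c₁/8) X²` with `X² = L² ‖φ₂‖² ‖Ω‖²`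
  set X : ℝ := Real.sqrt ((L : ℝ) ^ 2 * nφ * nΩ) with hX
  have hX0 : 0 ≤ X := Real.sqrt_nonneg _
  have hX2 : X ^ 2 = (L : ℝ) ^ 2 * nφ * nΩ := Real.sq_sqrt (by positivity)
  have hB2 : c₁ / 8 * X ^ 2 ≤ ‖B‖ ^ 2 := by
    rw [hX2]
    calc c₁ / 8 * ((L : ℝ) ^ 2 * nφ * nΩ) = c₁ * nφ * ((L : ℝ) ^ 2 / 8 * nΩ) := by ring
      _ ≤ c₁ * nφ * ∑ c ∈ T, (star (jwEmbed (orbEmb (f c)) (vecMulVec π (star σ)) *ᵥ Ω) ⬝ᵥ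
          (jwEmbed (orbEmb (f c)) (vecMulVec π (star σ)) *ᵥ Ω)).re :=
          mul_le_mul_of_nonneg_left hS (by positivity)
      _ ≤ ‖B‖ ^ 2 := hS1
  have hB1 : Real.sqrt (c₁ / 8) * X ≤ ‖B‖ := by
    have h1 : Real.sqrt (c₁ / 8 * X ^ 2) ≤ Real.sqrt (‖B‖ ^ 2) := Real.sqrt_le_sqrt hB2
    rwa [Real.sqrt_mul (by positivity), Real.sqrt_sq hX0, Real.sqrt_sq (norm_nonneg _)] at h1
  -- `|D − (m/2) B| ≤ η X`
  have hR1 : ‖D - m / 2 * B‖ ≤ η * X := by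
    have h0 : ‖D - m / 2 * B‖ ^ 2 ≤ (η * X) ^ 2 := by
      rw [mul_pow, hX2]
      calc ‖D - m / 2 * B‖ ^ 2 ≤ η ^ 2 * (L : ℝ) ^ 2 * nφ * nΩ := hS3
        _ = η ^ 2 * ((L : ℝ) ^ 2 * nφ * nΩ) := by ring
    have h1 := Real.sqrt_le_sqrt h0
    rwa [Real.sqrt_sq (norm_nonneg _), Real.sqrt_sq (by positivity)] at h1
  -- the triangle inequality
  have hsq : Real.sqrt (c₁ / 8) = 2 * Real.sqrt (c₁ / 32) := by
    have : c₁ / 8 = 2 ^ 2 * (c₁ / 32) := by ring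
    rw [this, Real.sqrt_mul (by positivity), Real.sqrt_sq (by norm_num)]
  have hmain : (‖m‖ * Real.sqrt (c₁ / 32) - η) * X ≤ ‖D‖ := by
    have htri : ‖m / 2 * B‖ ≤ ‖D - m / 2 * B‖ + ‖D‖ := by
      have := norm_sub_le (D - m / 2 * B) D
      rwa [sub_sub_cancel_left, norm_neg] at this
    have hmB : ‖m / 2 * B‖ = ‖m‖ / 2 * ‖B‖ := by
      rw [norm_mul, norm_div, Complex.norm_two]
    have h2 : ‖m‖ / 2 * (Real.sqrt (c₁ / 8) * X) ≤ ‖m‖ / 2 * ‖B‖ :=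
      mul_le_mul_of_nonneg_left hB1 (by positivity)
    rw [hsq] at h2
    have h3 : ‖m‖ * Real.sqrt (c₁ / 32) * X ≤ ‖m‖ / 2 * ‖B‖ := by
      calc ‖m‖ * Real.sqrt (c₁ / 32) * X = ‖m‖ / 2 * (2 * Real.sqrt (c₁ / 32) * X) := by ring
        _ ≤ ‖m‖ / 2 * ‖B‖ := h2
    have h4 : (‖m‖ * Real.sqrt (c₁ / 32) - η) * X = ‖m‖ * Real.sqrt (c₁ / 32) * X - η * X := by ring
    rw [h4]
    linarith [htri, hmB, h3, hR1]
  have hfin := pow_le_pow_left₀ (mul_nonneg (sub_nonneg.2 hη) hX0) hmain 2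
  rw [mul_pow, hX2] at hfin
  calc (‖m‖ * Real.sqrt (c₁ / 32) - η) ^ 2 * (L : ℝ) ^ 2 * nΩ * nφ
      = (‖m‖ * Real.sqrt (c₁ / 32) - η) ^ 2 * ((L : ℝ) ^ 2 * nφ * nΩ) := by ring
    _ ≤ ‖D‖ ^ 2 := hfin


/-! ### Registered form -/

/-- **Registered sub-goal `dWaveResidue_coreEstimate`** (closed form, as registered on the crux item):
the `d`-wave residue at one even side `L` from the rank-one plaquette defect form and the two
structure hypotheses S1, S3. [folklore] -/
theorem dWaveResidue_coreEstimate : ∀ {L : ℕ} [NeZero L], Even L → ∀ (U μ γ b : ℝ), 0 < γ → 0 < b → b ≤ γ / 128 → ∀ {σ π : Fock (Orb (FermionTorus 2 2))}, star σ ⬝ᵥ σ = 1 → σ ∈ szSector (Λ := FermionTorus 2 2) 4 0 → hubbardTorus 2 2 1 U *ᵥ σ = (((hubbardTorus 2 2 1 U).minEnergyOn (szSector 4 0) : ℝ) : ℂ) • σ → (∀ v : Fock (Orb (FermionTorus 2 2)), γ * ((star v ⬝ᵥ v).re - (star v ⬝ᵥ (vecMulVec σ (star σ) *ᵥ v)).re)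 ≤ (star v ⬝ᵥ ((hubbardTorus 2 2 1 U - (μ : ℂ) • totalNumber) *ᵥ v)).re - ((hubbardTorus 2 2 1 U).minEnergyOn (szSector 4 0) - 4 * μ) * (star v ⬝ᵥ v).re) → star π ⬝ᵥ π = 1 → ∀ {f : ℕ × ℕ → (FermionTorus 2 2 ↪o FermionTorus 2 L)}, (∀ c ∈ Finset.range (L / 2) ×ˢ Finset.range (L / 2), ∀ X j, (ofLex (f c X) j : ℕ) = ![c.1 * 2, c.2 * 2] j + (ofLex X j : ℕ)) → ∀ {p : ℕ}, L ^ 2 = 2 * p → ∀ {Ω : Fock (Orb (FermionTorus 2 L))}, IsGroundStateInSector (hamiltonian (fermionTorusGraph 2 L \ (⊤ : SimpleGraph (Fin 2 → ℕ)).comap (fun (x : FermionTorus 2 L) (i : Fin 2) => (ofLex x i : ℕ) / 2)) 1 U + hamiltonian (fermionTorusGraph 2 L ⊓ (⊤ : SimpleGraph (Fin 2 → ℕ)).comap (fun (x : FermionTorus 2 L) (i : Fin 2) => (ofLex x i : ℕ) / 2)) b 0) (2 * p) 0 Ω → ∀ (φ₂ : Fock (Orb (FermionTorus 2 L))) (m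 : ℂ) {c₁ η : ℝ}, 0 ≤ c₁ → 0 ≤ η → η ≤ ‖m‖ * Real.sqrt (c₁ / 32) → c₁ * (star φ₂ ⬝ᵥ φ₂).re * ∑ c ∈ Finset.range (L / 2) ×ˢ Finset.range (L / 2), (star (jwEmbed (orbEmb (f c)) (vecMulVec π (star σ)) *ᵥ Ω) ⬝ᵥ (jwEmbed (orbEmb (f c)) (vecMulVec π (star σ)) *ᵥ Ω)).re ≤ ‖star φ₂ ⬝ᵥ ((∑ c ∈ Finset.range (L / 2) ×ˢ Finset.range (L / 2), jwEmbed (orbEmb (f c)) (vecMulVec π (star σ))) *ᵥ Ω)‖ ^ 2 → ‖star φ₂ ⬝ᵥ (pairField dWaveFormFactor L *ᵥ Ω) - m / 2 * (star φ₂ ⬝ᵥ ((∑ c ∈ Finset.range (L / 2) ×ˢ Finset.range (L / 2), jwEmbed (orbEmb (f c)) (vecMulVec π (star σ))) *ᵥ Ω))‖ ^ 2 ≤ η ^ 2 * (L : ℝ) ^ 2 * (star φ₂ ⬝ᵥ φ₂).re * (star Ω ⬝ᵥ Ω).re → (‖m‖ * Real.sqrt (c₁ / 32) - η) ^ 2 *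 (L : ℝ) ^ 2 * (star Ω ⬝ᵥ Ω).re * (star φ₂ ⬝ᵥ φ₂).re ≤ ‖star φ₂ ⬝ᵥ (pairField dWaveFormFactor L *ᵥ Ω)‖ ^ 2 := by
  intro L _ hL U μ γ b hγ hb0 hbγ σ π hσ1 hσS hσE hdef hπ1 f hf p hp Ω hΩ φ₂ m c₁ η hc₁ hη0 hη hS1 hS3
  exact dWaveResidue_core hL U μ γ b hγ hb0 hbγ hσ1 hσS hσE hdef hπ1 hf hp hΩ φ₂ m hc₁ hη0 hη hS1 hS3

end Summit.HubbardSuperconductivity.HubbardSuperconductivity.Theorems.CooperPairDMottWalk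

end
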